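import Summits.HodgeConjecture.HodgeConjecture.Theses.HeckePrymWeil
import Literature.AlgebraicGeometry.HodgeTheory.MotivatedClasses
import Literature.AlgebraicGeometry.Motives.AbelianVarietyProjectiveChart
import HarnessLib

/-!
# The `ℚ(√-p)` Hodge–Weil sector below Grothendieck's standard conjecture `B` (André 1996)

Route `HeckePrymWeil` (sub-problem `HodgeConjecture`); lead seat c4 of crux `WeilTwelvefoldsSqrtMinus7`
(stmt-HodgeConjecture-1261).  A second, family-free conditional closure of the crux and of every rung
predicate `HWA(p, k)` of the route, recording formally the refuters' standing remark "a kill of any rung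
refutes Lefschetz `B`" (Disproof.lean §5 of this crux) in its positive form:

  `(∀ Z η, B(Z, η))` ∧ [André 1996, §2.1 remark: under `B` motivated classes are algebraic]
  ∧ [André 1996, Thm. 0.6.2: Hodge classes on complex abelian varieties are motivated]
  ⟹ every rational `(p,p)` class on every complex abelian variety is algebraic
  ⟹ `HWA(p, k)` for all `p, k`, the three rungs, the target `HodgeWeilLadder`.

The two André statements are the tree's named facts
`Andre1996_motivatedClasses_le_algebraicClasses_of_standardConjectureB` and
`Andre1996_hodgeClasses_abelianVariety_motivated` (`HodgeTheory/MotivatedClasses`, on the real carriers);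
`B` is the tree's per-`(Z, η)` predicate `StandardConjectureBStar` (OPEN CONJECTURE — these are
CONDITIONAL results; nothing here bears on `B`).  Compare the family-based closure
`Theorems/HeckePrymWeilHodgeWeilOfLevelStructure` (trust base: Deligne's level-`n` family M3 + the crux
`WeilVariationalHodge`): the two trust bases are alternatives; neither file uses the other.
No definition, no `sorry`.
-/

noncomputable section

-- every declaration of this problem lives in `Summit.HodgeConjecture.HodgeConjecture.…` (summit = sub-problem)
set_option linter.dupNamespace false

open CategoryTheory

namespace Summit.HodgeConjecture.HodgeConjecture.Theorems.HeckePrymWeilLine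

open Literature.AlgebraicGeometry Literature.AlgebraicGeometry.Motives Literature.AlgebraicGeometry.HodgeTheory
open Summit.HodgeConjecture.HodgeConjecture.Theses.HeckePrymWeil

/-- **Hodge classes on complex abelian varieties are algebraic, GIVEN `B` and André's two statements**
(CONDITIONAL result): a rational class of Hodge type `(q,q)` in `H^{2q}(A(ℂ); ℂ)` is motivated
(André Thm. 0.6.2, `hAM`), and motivated classes are algebraic once every Lefschetz involution is an
algebraic correspondence (André §2.1 remark, `hBA`, fed with `hB`).  The smooth-projectivity witness is
the tree's `AbelianVariety.isSmoothProjective_holds`.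
[cite: Andre1996Motifs, Thm. 0.6.2 (p. 9) and §2.1 remark following Déf. 1 (p. 14)]
[cite: Grothendieck1968, §3 p. 196 (B(X))] -/
theorem hodgeClasses_abelianVariety_algebraic_of_standardConjectureB
    (hB : ∀ (d : ℕ) (Z : SchemeOver ℂ) (η : complexBetti Z 2), IsSmoothProjective d Z →
      StandardConjectureBStar d Z η)
    (hBA : Andre1996_motivatedClasses_le_algebraicClasses_of_standardConjectureB)
    (hAM : Andre1996_hodgeClasses_abelianVariety_motivated)
    (A : AbelianVariety ℂ) (q : ℕ) (c : complexBetti A.X (2 * q)) (hrat : IsRationalClass c)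
    (hH : IsOfHodgeType A.dim A.X (2 * q) q q c) : c ∈ algebraicClasses A.X q :=
  hBA hB (AbelianVariety.isSmoothProjective_holds (A := A)) q
    (hAM A (AbelianVariety.isSmoothProjective_holds (A := A)) q c hrat hH)

/-- **Every rung predicate `HWA(p, k)` of the route, GIVEN `B` and André's two statements**
(CONDITIONAL result; the Weil-plane hypothesis and `φ` are not even used: under `B` every rational
`(k,k)` class on the `2k`-fold `A` is algebraic). [cite: Andre1996Motifs, Thm. 0.6.2 and §2.1 remark]
[cite: Grothendieck1968, §3 p. 196 (B(X))] -/
theorem hodgeWeil_of_standardConjectureB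
    (hB : ∀ (d : ℕ) (Z : SchemeOver ℂ) (η : complexBetti Z 2), IsSmoothProjective d Z →
      StandardConjectureBStar d Z η)
    (hBA : Andre1996_motivatedClasses_le_algebraicClasses_of_standardConjectureB)
    (hAM : Andre1996_hodgeClasses_abelianVariety_motivated) :
    ∀ (p k : ℕ) (A : AbelianVariety ℂ) (φ : A ⟶ A), A.dim = 2 * k → φ ≫ φ = -((p : ℤ) • 𝟙 A) →
      ∀ c : complexBetti A.X (2 * k), IsRationalClass c → IsOfHodgeType (2 * k) A.X (2 * k) k k c →
        c ∈ Module.End.eigenspace (complexBetti.map (𝟙 A + φ).hom.hom.hom (2 * k)).hom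
              ((1 + Complex.I * (Real.sqrt (p : ℝ) : ℂ)) ^ (2 * k)) ⊔
            Module.End.eigenspace (complexBetti.map (𝟙 A + φ).hom.hom.hom (2 * k)).hom
              ((1 - Complex.I * (Real.sqrt (p : ℝ) : ℂ)) ^ (2 * k)) →
        c ∈ algebraicClasses A.X k := by
  intro p k A φ hA _hφ c hrat hH _hW
  refine hodgeClasses_abelianVariety_algebraic_of_standardConjectureB hB hBA hAM A k c hrat ?_
  rw [hA]
  exact hH

/-- **The crux `WeilTwelvefoldsSqrtMinus7` (stmt-HodgeConjecture-1261) GIVEN `B` and André's two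
statements** (CONDITIONAL result). [cite: Andre1996Motifs, Thm. 0.6.2 and §2.1 remark]
[cite: Grothendieck1968, §3 p. 196 (B(X))] -/
theorem weilTwelvefoldsSqrtMinus7_of_standardConjectureB
    (hB : ∀ (d : ℕ) (Z : SchemeOver ℂ) (η : complexBetti Z 2), IsSmoothProjective d Z →
      StandardConjectureBStar d Z η)
    (hBA : Andre1996_motivatedClasses_le_algebraicClasses_of_standardConjectureB)
    (hAM : Andre1996_hodgeClasses_abelianVariety_motivated) : WeilTwelvefoldsSqrtMinus7 := by
  intro A φ hA hφ c hrat hH hW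
  exact hodgeWeil_of_standardConjectureB hB hBA hAM 7 6 A φ hA (by exact_mod_cast hφ) c hrat hH
    (by exact_mod_cast hW)

/-- **The route target `HodgeWeilLadder` (stmt-HodgeConjecture-1259) GIVEN `B` and André's two
statements** (CONDITIONAL result). [cite: Andre1996Motifs, Thm. 0.6.2 and §2.1 remark]
[cite: Grothendieck1968, §3 p. 196 (B(X))] -/
theorem hodgeWeilLadder_of_standardConjectureB
    (hB : ∀ (d : ℕ) (Z : SchemeOver ℂ) (η : complexBetti Z 2), IsSmoothProjective d Z →
      StandardConjectureBStar d Z η)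
    (hBA : Andre1996_motivatedClasses_le_algebraicClasses_of_standardConjectureB)
    (hAM : Andre1996_hodgeClasses_abelianVariety_motivated) : HodgeWeilLadder := by
  intro p _hp _hp4 _hp7 g _hg n _hn A φ hA hφ c hrat hH hW
  exact hodgeWeil_of_standardConjectureB hB hBA hAM p n A φ hA hφ c hrat hH hW

end Summit.HodgeConjecture.HodgeConjecture.Theorems.HeckePrymWeilLine

end
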